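import Literature.AlgebraicGeometry.ModuliOfAbelianVarieties.SiegelCMStructureFreeRankOne
import Literature.NumberTheory.ComplexMultiplication.CMTypeLattice
import HarnessLib

/-!
# The period isomorphism of a CM special pair on the Siegel datum:
# `(ℝ^{2g}, J, act ⊃ ℚ^{2g}) ≅ (∏ᵢ ℂ^{Φᵢ}, √−1, F = ∏ᵢ Kᵢ)` ([Deligne 1971] 4.18; [Milne ISV] Ex. 12.4 (b))

Topic `AlgebraicGeometry/ModuliOfAbelianVarieties`; namespace
`Literature.AlgebraicGeometry.ModuliOfAbelianVarieties.CMStructure`.  THEOREMS ONLY (no definition, no named fact, no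
instance, no `sorry`; net Literature debt **0**).  Sequel of ★ (σ4)-D `SiegelCanonicalModel` (`CMStructure`, `IsSpecial`),
★ R60-14 `SiegelCMStructureFreeRankOne` (cyclic vectors) and ★ `CMTypeLattice` (Shimura's `u : K → ℂ^Φ`).
Cell hodgecm-mathlib (D-0151), banked GENERIC leaf R60-33 toward fan-B row I-7 (#60) `SiegelS1` (director g6 RULING
s86 (2)(b); A-p05's MUMFORD-LINE-SPEC §3 step 3: «the point `[J, a]` is the CM structure `(V/L_a, J, act)` … so
`(V_ℝ, J)/L_a ≅ (F ⊗ ℝ)_Φ / q(L_a)` = a CM-algebra torus of type `Φ` with lattice `L_a ⊂ F`»).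

WHAT IS PROVED.  Let `c` be a CM structure of type `δ` ([Deligne1971TravauxShimura] 4.18): an injective `ℚ`-algebra map
`act : F = ∏ᵢ Kᵢ → End_ℚ(ℚ^{2g})`, `Kᵢ` CM number fields, `Σᵢ [Kᵢ : ℚ] = 2g`; let `Φ = (Φᵢ)` be CM types and
`Ψ(x) = (φ(xᵢ))_{i, φ ∈ Φᵢ} ∈ W = ∏ᵢ ℂ^{Φᵢ}` the diagonal CM embedding (★ `CMTypeLattice.cmEmbedding (Φ i)` factorwise).
* §1 `dim_ℝ W = Σᵢ [Kᵢ:ℚ]` and `span_ℝ Ψ(F) = W` (from ★ `CMTypeLattice.finrank_real_pi` / `span_range_cmEmbedding_eq_top`).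
* §3 `IsSpecial.map_mulVec_eq_I_smul_of_equivariant` — THE EIGENVECTOR CLAUSE PINS `J`: for ANY `ℝ`-linear chart
  `E : ℝ^{2g} ≃ W` with `E(act(x)·v) = Ψ(x)·E(v)` and any special pair `(c, J, Φ)` (★ `IsSpecial`), `E(J·v) = √−1·E(v)`.
  Proof: for `φ₀ ∈ Φ_{i₀}` and the elementary vector `δ = δ_{i₀φ₀}`, the complex vector
  `v = E⁻¹(δ) − √−1·E⁻¹(√−1·δ) ∈ ℂ^{2g}` is a common eigenvector of `K_{i₀}` with character `φ₀`, so `J ⊗ ℂ = +√−1` on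
  it by the eigenvector clause of `IsSpecial`; its real and imaginary parts give `J E⁻¹(δ) = E⁻¹(√−1 δ)`,
  `J E⁻¹(√−1 δ) = −E⁻¹(δ)`, and the `E⁻¹(z δ_{iφ})` span `ℝ^{2g}`.  (The commuting clause of `IsSpecial` is not used.)
* §4 `exists_linearEquiv_cmEmbedding` — THE `F`-EQUIVARIANT CHART: for every `c` and `Φ` there is
  `e : ℝ^{2g} ≃ₗ[ℝ] W` with `e(act(x)·v) = Ψ(x)·e(v)` and `e(act(x)·v₀) = Ψ(x)` at a cyclic vector `v₀`
  (★ R60-14 `exists_linearEquiv_act`): the `ℝ`-linear extension of `act(x)·v₀ ↦ Ψ(x)`, onto because `Ψ(F)` spans,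
  bijective by the dimension count `2g = Σᵢ [Kᵢ:ℚ] = dim_ℝ W`.
* §5 HEAD `IsSpecial.exists_periodIso` — for a special pair `(c, J, Φ)`: `∃ e : ℝ^{2g} ≃ₗ[ℝ] ∏ᵢ ℂ^{Φᵢ}` with
  (a) `e(J·v) = √−1·e(v)`, (b) `e(act(x)·v) = Ψ(x)·e(v)`, (c) `e(act(x)·v₀) = Ψ(x)` for a cyclic `v₀` — the special
  point `(ℝ^{2g}, J)` with its `F`-action and rational structure IS `((F ⊗ ℝ)_Φ, √−1, F)`; a lattice `L ⊂ ℚ^{2g}`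
  becomes `Ψ(q⁻¹L) ⊂ ∏ᵢ u(Kᵢ)`, the currency of ★ `CMTypeLattice.idealLattice` / ★ `CMTypeUniformization`
  (`periodIso Φ 𝔞`) in which ★ row II-1 (Shimura 18.6) and R60-28 (its isogeny form) are typed.
[Milne2005ShimuraVarieties] Ex. 12.4 (b) p. 112: «`h_Φ(z)` acts on `V_φ` as multiplication by `φ(z)`»; [Shimura1998] §6.2
Thm. 3–4: `u(x) = (x^{φ_1}, …, x^{φ_n})`, `F_ℝ ≅ ℂⁿ`.  Nothing printed is asserted.  HC_CM is proved only modulo the 7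
printed citations until rung 0 closes.

## References
* [Deligne1971TravauxShimura] P. Deligne, *Travaux de Shimura*, Sém. Bourbaki 389 (1971), 4.18 p. 150.
* [Milne2005ShimuraVarieties] J. S. Milne, *Introduction to Shimura varieties* (2005), Ex. 12.4 (b) p. 112, §14 p. 125.
* [Shimura1998] G. Shimura, *Abelian Varieties with Complex Multiplication and Modular Functions* (1998), §6.2 Thm. 3–4,
  pp. 42–45; §5.1 Lemma 1.
* [MilneCM2006] J. S. Milne, *Complex Multiplication* (2006), Ch. I §1 (`E ⊗ ℝ ≅ ℂ^Φ`).
-/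

set_option autoImplicit false

noncomputable section

open scoped Classical
open Matrix NumberField Module Function

namespace Literature.AlgebraicGeometry.ModuliOfAbelianVarieties

namespace CMStructure

open Literature.AlgebraicGeometry.Motives (CMType)
open Literature.NumberTheory.ComplexMultiplication (CMTypeLattice.cmEmbedding
  CMTypeLattice.finrank_real_pi CMTypeLattice.span_range_cmEmbedding_eq_top CMTypeLattice.cmEmbedding_apply)

variable {g : ℕ} {δ : Fin g → ℕ} {ι : Type} [Fintype ι] [DecidableEq ι] {K : ι → Type} [∀ i, Field (K i)]
  [∀ i, NumberField (K i)] [∀ i, IsCMField (K i)]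

/-! ### §1. The target `W = ∏ᵢ ℂ^{Φᵢ}` and the diagonal embedding `Ψ(x) = (φ(xᵢ))_{i, φ ∈ Φᵢ}` -/

omit [DecidableEq ι] [∀ i, IsCMField (K i)] in
/-- **`dim_ℝ ∏ᵢ ℂ^{Φᵢ} = Σᵢ [Kᵢ : ℚ]`** (factorwise ★ `CMTypeLattice.finrank_real_pi`: `dim_ℝ ℂ^Φ = 2·#Φ = [K:ℚ]`).
[cite: Shimura1998, §6.1 Thm. 2, p. 41] [cite: MilneCM2006, Ch. I §1] -/
theorem finrank_real_pi_cmType (Φ : ∀ i, CMType (K i)) :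
    finrank ℝ (Π i, ((Φ i).1 → ℂ)) = ∑ i, finrank ℚ (K i) := by
  rw [finrank_pi_fintype ℝ]
  exact Finset.sum_congr rfl fun i _ => CMTypeLattice.finrank_real_pi (Φ i)

omit [∀ i, IsCMField (K i)] in
/-- **`Ψ(F)` spans `∏ᵢ ℂ^{Φᵢ}` over `ℝ`**, `Ψ(x) = (φ(xᵢ))_{i, φ ∈ Φᵢ}`: factorwise Shimura's «the `u(αᵢ)` are linearly
independent over `ℝ`» (★ `CMTypeLattice.span_range_cmEmbedding_eq_top`), assembled along the coordinate inclusions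
`ℂ^{Φᵢ} ↪ ∏ⱼ ℂ^{Φⱼ}` (`Ψ(ιᵢ y) = ιᵢ u(y)`). [cite: Shimura1998, §6.2, proof of Thm. 3, p. 42] [cite: MilneCM2006, Ch. I §1] -/
theorem span_range_pi_cmEmbedding_eq_top (Φ : ∀ i, CMType (K i)) :
    Submodule.span ℝ (Set.range fun x : Π i, K i => fun i => CMTypeLattice.cmEmbedding (Φ i) (x i)) =
      (⊤ : Submodule ℝ (Π i, ((Φ i).1 → ℂ))) := by
  apply top_unique
  rw [← LinearMap.iSup_range_single ℝ (fun i => ((Φ i).1 → ℂ))]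
  refine iSup_le fun i => ?_
  rw [LinearMap.range_eq_map, ← CMTypeLattice.span_range_cmEmbedding_eq_top (Φ i), Submodule.map_span,
    Submodule.span_le]
  rintro _ ⟨_, ⟨y, rfl⟩, rfl⟩
  refine Submodule.subset_span ⟨Pi.single i y, ?_⟩
  funext j
  change CMTypeLattice.cmEmbedding (Φ j) (Pi.single (M := K) i y j) =
    (Pi.single i (CMTypeLattice.cmEmbedding (Φ i) y) : Π i, ((Φ i).1 → ℂ)) j
  by_cases hj : j = i
  · subst hj
    simp only [Pi.single_eq_same]
  · rw [Pi.single_eq_of_ne hj, map_zero, Pi.single_eq_of_ne hj]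

/-! ### §2. Real matrices on complex vectors written as `(re, im)` pairs -/

/-- A real matrix acts on a complex vector `k ↦ ⟨a k, b k⟩` through its real and imaginary parts:
`(M ⊗ ℂ)·(a + b√−1) = M·a + (M·b)√−1`. [folklore] -/
private theorem map_ofReal_mulVec_mk {n : Type} [Fintype n] (M : Matrix n n ℝ) (a b : n → ℝ) :
    M.map (algebraMap ℝ ℂ) *ᵥ (fun k => (⟨a k, b k⟩ : ℂ)) = fun k => (⟨(M *ᵥ a) k, (M *ᵥ b) k⟩ : ℂ) := by
  funext k
  apply Complex.ext
  · simp only [Matrix.mulVec, dotProduct, Matrix.map_apply, Complex.coe_algebraMap, Complex.re_sum,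
      Complex.mul_re, Complex.ofReal_re, Complex.ofReal_im, zero_mul, sub_zero]
  · simp only [Matrix.mulVec, dotProduct, Matrix.map_apply, Complex.coe_algebraMap, Complex.im_sum,
      Complex.mul_im, Complex.ofReal_re, Complex.ofReal_im, zero_mul, add_zero]

/-- `(M ⊗_ℚ ℂ) = (M ⊗_ℚ ℝ) ⊗_ℝ ℂ` for a rational matrix. [folklore] -/
private theorem map_rat_complex_eq {n : Type} (M : Matrix n n ℚ) :
    M.map (algebraMap ℚ ℂ) = (M.map (algebraMap ℚ ℝ)).map (algebraMap ℝ ℂ) := by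
  ext j k
  simp only [Matrix.map_apply, eq_ratCast, Complex.coe_algebraMap, Complex.ofReal_ratCast]

/-- A rational matrix acts on the real vector `ℚ^{2g} ∋ w ↦ w ⊗ 1` through its rational action. [folklore] -/
private theorem map_rat_real_mulVec {n : Type} [Fintype n] (M : Matrix n n ℚ) (w : n → ℚ) :
    M.map (algebraMap ℚ ℝ) *ᵥ ((algebraMap ℚ ℝ) ∘ w) = (algebraMap ℚ ℝ) ∘ (M *ᵥ w) := by
  funext k
  exact (RingHom.map_mulVec (algebraMap ℚ ℝ) M w k).symm

/-! ### §3. The complex structure of a special pair is `√−1` in any `F`-equivariant chart `ℝ^{2g} ≅ ∏ᵢ ℂ^{Φᵢ}` -/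

/-- **The eigenvector clause of `IsSpecial` pins `J` to `√−1`.**  Let `E : ℝ^{2g} ≃ ∏ᵢ ℂ^{Φᵢ}` be an `ℝ`-linear
chart intertwining the action of `F = ∏ Kᵢ` (`act(x) ↦` coordinatewise multiplication by `(φ(xᵢ))_{i,φ}`).  Then for
every special pair `(c, J, Φ)` the complex structure `J` is carried to multiplication by `√−1`: for `φ₀ ∈ Φ_{i₀}` the
vector `v = E⁻¹(δ_{i₀φ₀}) − √−1·E⁻¹(√−1 δ_{i₀φ₀}) ∈ ℂ^{2g}` is a common eigenvector of `K_{i₀}` with character `φ₀`, on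
which `J ⊗ ℂ = +√−1` by `IsSpecial`; reading off real and imaginary parts, `J E⁻¹(δ) = E⁻¹(√−1 δ)` and
`J E⁻¹(√−1 δ) = −E⁻¹(δ)`, and these vectors span. [cite: Milne2005ShimuraVarieties, Ex. 12.4 (b) p. 112]
[cite: Deligne1971TravauxShimura, 4.18 p. 150] -/
theorem IsSpecial.map_mulVec_eq_I_smul_of_equivariant {c : CMStructure g δ ι K} {J : C0pm δ}
    {Φ : ∀ i, CMType (K i)} (h : c.IsSpecial J Φ)
    (E : (Fin g ⊕ Fin g → ℝ) ≃ₗ[ℝ] (Π i, ((Φ i).1 → ℂ)))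
    (hE : ∀ (x : Π i, K i) (v : Fin g ⊕ Fin g → ℝ),
      E ((c.actMatrix x).map (algebraMap ℚ ℝ) *ᵥ v) = (fun i => CMTypeLattice.cmEmbedding (Φ i) (x i)) * E v)
    (v : Fin g ⊕ Fin g → ℝ) :
    E ((J : Matrix (Fin g ⊕ Fin g) (Fin g ⊕ Fin g) ℝ) *ᵥ v) = Complex.I • E v := by
  -- notation: the elementary vectors `δ z = δ_{i₀φ₀}·z` of `W = ∏ᵢ ℂ^{Φᵢ}`
  set W := (Π i, ((Φ i).1 → ℂ)) with hW
  -- Step 1: `act(ι_{i₀} x) · δ_{i₀φ₀} z = δ_{i₀φ₀} (φ₀(x) z)`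
  have hmul : ∀ (i₀ : ι) (φ₀ : (Φ i₀).1) (x : K i₀) (z : ℂ),
      (fun i => CMTypeLattice.cmEmbedding (Φ i) (Pi.single (M := K) i₀ x i)) *
          (Pi.single i₀ (Pi.single φ₀ z) : W) =
        Pi.single i₀ (Pi.single φ₀ (φ₀.1 x * z)) := by
    intro i₀ φ₀ x z
    funext i φ
    change CMTypeLattice.cmEmbedding (Φ i) (Pi.single (M := K) i₀ x i) φ *
        (Pi.single i₀ (Pi.single φ₀ z) : W) i φ = (Pi.single i₀ (Pi.single φ₀ (φ₀.1 x * z)) : W) i φ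
    by_cases hi : i = i₀
    · subst hi
      simp only [Pi.single_eq_same, CMTypeLattice.cmEmbedding_apply]
      by_cases hφ : φ = φ₀
      · subst hφ
        simp only [Pi.single_eq_same]
      · simp only [Pi.single_eq_of_ne hφ, mul_zero]
    · simp only [Pi.single_eq_of_ne hi, Pi.zero_apply, mul_zero]
  -- Step 2: the real vectors `T z = E⁻¹(δ_{i₀φ₀} z)` and the action of `K_{i₀}` on them
  have hsingle_add : ∀ (i₀ : ι) (φ₀ : (Φ i₀).1) (z z' : ℂ),
      (Pi.single i₀ (Pi.single φ₀ (z + z')) : W) = Pi.single i₀ (Pi.single φ₀ z) + Pi.single i₀ (Pi.single φ₀ z') := by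
    intro i₀ φ₀ z z'
    rw [Pi.single_add, Pi.single_add]
  have hsingle_smul : ∀ (i₀ : ι) (φ₀ : (Φ i₀).1) (r : ℝ) (z : ℂ),
      (Pi.single i₀ (Pi.single φ₀ ((r : ℂ) * z)) : W) = r • Pi.single i₀ (Pi.single φ₀ z) := by
    intro i₀ φ₀ r z
    rw [← Complex.real_smul, Pi.single_smul, Pi.single_smul]
  have hsingle_I : ∀ (i₀ : ι) (φ₀ : (Φ i₀).1) (z : ℂ),
      (Pi.single i₀ (Pi.single φ₀ (Complex.I * z)) : W) = Complex.I • Pi.single i₀ (Pi.single φ₀ z) := by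
    intro i₀ φ₀ z
    rw [← smul_eq_mul, Pi.single_smul, Pi.single_smul]
  -- decomposition `z = re z + im z · √−1` on the elementary vectors
  have hdecomp : ∀ (i₀ : ι) (φ₀ : (Φ i₀).1) (z : ℂ),
      (Pi.single i₀ (Pi.single φ₀ z) : W) =
        z.re • (Pi.single i₀ (Pi.single φ₀ 1) : W) + z.im • (Pi.single i₀ (Pi.single φ₀ Complex.I) : W) := by
    intro i₀ φ₀ z
    rw [← hsingle_smul, ← hsingle_smul, ← hsingle_add, mul_one, Complex.re_add_im]
  -- Step 3: `J T(1) = T(√−1)` and `J T(√−1) = −T(1)` from the eigenvector clause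
  have hJT : ∀ (i₀ : ι) (φ₀ : (Φ i₀).1), ∃ T1 TI : Fin g ⊕ Fin g → ℝ,
      E T1 = (Pi.single i₀ (Pi.single φ₀ 1) : W) ∧ E TI = (Pi.single i₀ (Pi.single φ₀ Complex.I) : W) ∧
        (J : Matrix (Fin g ⊕ Fin g) (Fin g ⊕ Fin g) ℝ) *ᵥ T1 = TI ∧
        (J : Matrix (Fin g ⊕ Fin g) (Fin g ⊕ Fin g) ℝ) *ᵥ TI = -T1 := by
    intro i₀ φ₀
    obtain ⟨T1, hT1⟩ : ∃ T : Fin g ⊕ Fin g → ℝ, E T = (Pi.single i₀ (Pi.single φ₀ 1) : W) :=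
      ⟨E.symm _, E.apply_symm_apply _⟩
    obtain ⟨TI, hTI⟩ : ∃ T : Fin g ⊕ Fin g → ℝ, E T = (Pi.single i₀ (Pi.single φ₀ Complex.I) : W) :=
      ⟨E.symm _, E.apply_symm_apply _⟩
    refine ⟨T1, TI, hT1, hTI, ?_⟩
    -- the action of `x ∈ K_{i₀}` on `T1`, `TI`
    have hact1 : ∀ x : K i₀,
        (c.actMatrix (Pi.single i₀ x)).map (algebraMap ℚ ℝ) *ᵥ T1 = (φ₀.1 x).re • T1 + (φ₀.1 x).im • TI := by
      intro x
      apply E.injective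
      rw [hE, hT1, hmul, mul_one, map_add, map_smul, map_smul, hT1, hTI]
      exact hdecomp i₀ φ₀ (φ₀.1 x)
    have hact2 : ∀ x : K i₀,
        (c.actMatrix (Pi.single i₀ x)).map (algebraMap ℚ ℝ) *ᵥ TI = (-(φ₀.1 x).im) • T1 + (φ₀.1 x).re • TI := by
      intro x
      apply E.injective
      rw [hE, hTI, hmul, map_add, map_smul, map_smul, hT1, hTI, hdecomp i₀ φ₀ (φ₀.1 x * Complex.I),
        Complex.mul_I_re, Complex.mul_I_im]
    -- the complex eigenvector `v = T1 − √−1·TI` of `K_{i₀}` with character `φ₀`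
    have hv_eig : ∀ x : K i₀, (c.actMatrix (Pi.single i₀ x)).map (algebraMap ℚ ℂ) *ᵥ
        (fun k => (⟨T1 k, (-TI) k⟩ : ℂ)) = φ₀.1 x • (fun k => (⟨T1 k, (-TI) k⟩ : ℂ)) := by
      intro x
      rw [map_rat_complex_eq, map_ofReal_mulVec_mk _ T1 (-TI), Matrix.mulVec_neg, hact1 x, hact2 x]
      funext k
      apply Complex.ext
      · simp only [Pi.add_apply, Pi.smul_apply, Pi.neg_apply, smul_eq_mul, Complex.mul_re]
        ring
      · simp only [Pi.add_apply, Pi.smul_apply, Pi.neg_apply, smul_eq_mul, Complex.mul_im]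
        ring
    have hJv := (h.2 i₀ φ₀.1 _ hv_eig).1 φ₀.2
    rw [map_ofReal_mulVec_mk _ T1 (-TI), Matrix.mulVec_neg] at hJv
    have hre : ∀ k, ((J : Matrix (Fin g ⊕ Fin g) (Fin g ⊕ Fin g) ℝ) *ᵥ T1) k = TI k := fun k => by
      have := congrArg Complex.re (congr_fun hJv k)
      simp only [Pi.smul_apply, Pi.neg_apply, smul_eq_mul, Complex.mul_re, Complex.I_re, Complex.I_im,
        zero_mul, one_mul, zero_sub, neg_neg] at this
      exact this
    have him : ∀ k, ((J : Matrix (Fin g ⊕ Fin g) (Fin g ⊕ Fin g) ℝ) *ᵥ TI) k = -T1 k := fun k => by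
      have := congrArg Complex.im (congr_fun hJv k)
      simp only [Pi.smul_apply, Pi.neg_apply, smul_eq_mul, Complex.mul_im, Complex.I_re, Complex.I_im,
        zero_mul, one_mul] at this
      linarith
    exact ⟨funext hre, funext fun k => by rw [him, Pi.neg_apply]⟩
  -- Step 4: `J T(z) = T(√−1 z)` for every `z`, i.e. `E (J E⁻¹ (δ z)) = √−1 • δ z`
  have hJz : ∀ (i₀ : ι) (φ₀ : (Φ i₀).1) (z : ℂ),
      E ((J : Matrix (Fin g ⊕ Fin g) (Fin g ⊕ Fin g) ℝ) *ᵥ E.symm (Pi.single i₀ (Pi.single φ₀ z) : W)) =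
        Complex.I • (Pi.single i₀ (Pi.single φ₀ z) : W) := by
    intro i₀ φ₀ z
    obtain ⟨T1, TI, hT1, hTI, hJ1, hJI⟩ := hJT i₀ φ₀
    have hT1s : E.symm (Pi.single i₀ (Pi.single φ₀ 1) : W) = T1 := by rw [← hT1, E.symm_apply_apply]
    have hTIs : E.symm (Pi.single i₀ (Pi.single φ₀ Complex.I) : W) = TI := by rw [← hTI, E.symm_apply_apply]
    conv_lhs => rw [hdecomp i₀ φ₀ z]
    rw [← hsingle_I, hdecomp i₀ φ₀ (Complex.I * z), Complex.I_mul_re, Complex.I_mul_im, map_add, map_smul,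
      map_smul, hT1s, hTIs, Matrix.mulVec_add, Matrix.mulVec_smul, Matrix.mulVec_smul, hJ1, hJI, map_add,
      map_smul, map_smul, map_neg, hT1, hTI, smul_neg, neg_smul, add_comm]
  -- Step 5: linearity over the elementary vectors
  have hw : ∀ w : W, w = ∑ i, ∑ φ, (Pi.single i (Pi.single φ (w i φ)) : W) := by
    intro w
    conv_lhs => rw [← Finset.univ_sum_single w]
    refine Finset.sum_congr rfl fun i _ => ?_
    conv_lhs => rw [← Finset.univ_sum_single (w i)]
    exact map_sum (AddMonoidHom.single (fun i => ((Φ i).1 → ℂ)) i) _ _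
  have key : ∀ w : W, E ((J : Matrix (Fin g ⊕ Fin g) (Fin g ⊕ Fin g) ℝ) *ᵥ E.symm w) = Complex.I • w := by
    intro w
    rw [hw w]
    simp only [map_sum, Matrix.mulVec_sum, Finset.smul_sum]
    refine Finset.sum_congr rfl fun i _ => Finset.sum_congr rfl fun φ _ => ?_
    exact hJz i φ (w i φ)
  have := key (E v)
  rwa [LinearEquiv.symm_apply_apply] at this

/-! ### §4. The `F`-equivariant chart `ℝ^{2g} ≅ ∏ᵢ ℂ^{Φᵢ}` of a CM structure (no complex structure involved) -/

/-- **THE `F`-EQUIVARIANT CHART.**  For a CM structure `c` (★ `CMStructure`: `act : F = ∏ᵢ Kᵢ ↪ End_ℚ(ℚ^{2g})`,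
`Σᵢ [Kᵢ:ℚ] = 2g`) and ANY family of CM types `Φ = (Φᵢ)`, there is an `ℝ`-linear isomorphism
`e : ℝ^{2g} ≃ ∏ᵢ ℂ^{Φᵢ}` carrying `act(x) ⊗ ℝ` to coordinatewise multiplication by `Ψ(x) = (φ(xᵢ))_{i, φ ∈ Φᵢ}`
(★ `CMTypeLattice.cmEmbedding (Φ i)`, Shimura's `u(x)`), normalised at a cyclic vector `v₀` of `act`
(★ R60-14 `exists_linearEquiv_act`): `e(act(x)·v₀) = Ψ(x)`, so the rational structure `ℚ^{2g}` is carried onto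
`Ψ(F) = ∏ᵢ u(Kᵢ)`.  Construction: `e` is the `ℝ`-linear extension of `act(x)·v₀ ↦ Ψ(x)`; it is onto because `Ψ(F)`
spans `∏ᵢ ℂ^{Φᵢ}` over `ℝ` (★ `CMTypeLattice.span_range_cmEmbedding_eq_top`), hence bijective by the dimension count
`dim_ℝ ∏ᵢ ℂ^{Φᵢ} = Σᵢ [Kᵢ:ℚ] = 2g` (★ `CMTypeLattice.finrank_real_pi`).  [Shimura1998] §6.1–6.2 (the map `u : F_ℝ ≅ ℂⁿ`);
[Milne2005ShimuraVarieties] Ex. 12.4 (b). [cite: Shimura1998, §6.2 Thm. 3–4, pp. 42–45]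
[cite: Milne2005ShimuraVarieties, Ex. 12.4 (b) p. 112] [cite: Deligne1971TravauxShimura, 4.18 p. 150] -/
theorem exists_linearEquiv_cmEmbedding (c : CMStructure g δ ι K) (Φ : ∀ i, CMType (K i)) :
    ∃ e : (Fin g ⊕ Fin g → ℝ) ≃ₗ[ℝ] (Π i, ((Φ i).1 → ℂ)),
      (∀ (x : Π i, K i) (v : Fin g ⊕ Fin g → ℝ),
        e ((c.actMatrix x).map (algebraMap ℚ ℝ) *ᵥ v) = (fun i => CMTypeLattice.cmEmbedding (Φ i) (x i)) * e v) ∧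
      ∃ v₀ : Fin g ⊕ Fin g → ℚ, Function.Bijective (fun x : Π i, K i => c.act x v₀) ∧
        ∀ x : Π i, K i, e ((algebraMap ℚ ℝ) ∘ (c.act x v₀)) = fun i => CMTypeLattice.cmEmbedding (Φ i) (x i) := by
  obtain ⟨q, hq⟩ := c.exists_linearEquiv_act
  -- the diagonal CM embedding `Ψ : F → ∏ᵢ ℂ^{Φᵢ}` as a ring homomorphism
  obtain ⟨Ψ, hΨ⟩ : ∃ Ψ : (Π i, K i) →+* (Π i, ((Φ i).1 → ℂ)),
      ∀ x, Ψ x = fun i => CMTypeLattice.cmEmbedding (Φ i) (x i) :=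
    ⟨RingHom.pi fun i => (CMTypeLattice.cmEmbedding (Φ i)).comp (Pi.evalRingHom K i), fun x => rfl⟩
  have hΨsmul : ∀ (r : ℚ) (y : Π i, K i), ((r : ℝ) • Ψ y : Π i, ((Φ i).1 → ℂ)) = Ψ (r • y) := by
    intro r y
    funext i φ
    rw [hΨ, hΨ]
    change ((r : ℝ) • ((φ.1 : K i →+* ℂ) (y i)) : ℂ) = (φ.1 : K i →+* ℂ) ((r • y) i)
    rw [Pi.smul_apply, Rat.smul_def, map_mul, map_ratCast, Complex.real_smul, Complex.ofReal_ratCast]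
  -- `F`-equivariance of `q⁻¹`
  have hrat : ∀ (x : Π i, K i) (w : Fin g ⊕ Fin g → ℚ), q.symm (c.act x w) = x * q.symm w := by
    intro x w
    apply q.injective
    rw [q.apply_symm_apply, hq, q.apply_symm_apply]
  -- the chart: `ℝ`-linear extension of `w ↦ Ψ(q⁻¹ w)` along the standard basis
  obtain ⟨e₀, he₀def⟩ : ∃ e₀ : (Fin g ⊕ Fin g → ℝ) →ₗ[ℝ] (Π i, ((Φ i).1 → ℂ)),
      ∀ v, e₀ v = ∑ k, v k • Ψ (q.symm (Pi.single k 1)) :=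
    ⟨(Pi.basisFun ℝ (Fin g ⊕ Fin g)).constr ℝ fun k => Ψ (q.symm (Pi.single k 1)), fun v => by
      rw [Basis.constr_apply_fintype]
      simp only [Pi.basisFun_equivFun, LinearEquiv.refl_apply]⟩
  have he₀ : ∀ w : Fin g ⊕ Fin g → ℚ, e₀ ((algebraMap ℚ ℝ) ∘ w) = Ψ (q.symm w) := by
    intro w
    rw [he₀def]
    have hw : (∑ k, w k • q.symm (Pi.single k (1 : ℚ))) = q.symm w := by
      conv_rhs => rw [← Finset.univ_sum_single w]
      rw [map_sum]
      refine Finset.sum_congr rfl fun k _ => ?_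
      rw [← map_smul, ← Pi.single_smul, smul_eq_mul, mul_one]
    rw [← hw, map_sum]
    refine Finset.sum_congr rfl fun k _ => ?_
    rw [Function.comp_apply, eq_ratCast, hΨsmul]
  -- (b) `e₀` intertwines `act(x)` with multiplication by `Ψ(x)`
  have hone : ∀ k : Fin g ⊕ Fin g,
      (Pi.single k (1 : ℝ) : Fin g ⊕ Fin g → ℝ) = (algebraMap ℚ ℝ) ∘ (Pi.single k (1 : ℚ)) := by
    intro k
    funext j
    by_cases hj : j = k
    · subst hj
      rw [Function.comp_apply, Pi.single_eq_same, Pi.single_eq_same, map_one]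
    · rw [Function.comp_apply, Pi.single_eq_of_ne hj, Pi.single_eq_of_ne hj, map_zero]
  have hb : ∀ (x : Π i, K i) (v : Fin g ⊕ Fin g → ℝ),
      e₀ ((c.actMatrix x).map (algebraMap ℚ ℝ) *ᵥ v) = (fun i => CMTypeLattice.cmEmbedding (Φ i) (x i)) * e₀ v := by
    intro x
    suffices hlin : e₀ ∘ₗ Matrix.toLin' ((c.actMatrix x).map (algebraMap ℚ ℝ)) =
        LinearMap.mulLeft ℝ (Ψ x) ∘ₗ e₀ by
      intro v
      have := LinearMap.congr_fun hlin v
      rw [LinearMap.comp_apply, LinearMap.comp_apply, Matrix.toLin'_apply, LinearMap.mulLeft_apply, hΨ] at this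
      exact this
    refine (Pi.basisFun ℝ (Fin g ⊕ Fin g)).ext fun k => ?_
    rw [LinearMap.comp_apply, LinearMap.comp_apply, Matrix.toLin'_apply, LinearMap.mulLeft_apply, Pi.basisFun_apply,
      hone, map_rat_real_mulVec, actMatrix_def, LinearMap.toMatrix'_mulVec, he₀, he₀, hrat, map_mul]
  -- bijectivity: onto a spanning set, equal dimensions
  have hsurj : Function.Surjective e₀ := by
    rw [← LinearMap.range_eq_top, eq_top_iff, ← span_range_pi_cmEmbedding_eq_top Φ, Submodule.span_le]
    rintro _ ⟨x, rfl⟩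
    refine ⟨(algebraMap ℚ ℝ) ∘ (q x), ?_⟩
    rw [he₀, q.symm_apply_apply, hΨ]
  have hfin : finrank ℝ (Fin g ⊕ Fin g → ℝ) = finrank ℝ (Π i, ((Φ i).1 → ℂ)) := by
    rw [finrank_real_pi_cmType, Module.finrank_fintype_fun_eq_card, Fintype.card_sum, Fintype.card_fin,
      c.sum_finrank_eq, two_mul]
  have hinj : Function.Injective e₀ :=
    (LinearMap.injective_iff_surjective_of_finrank_eq_finrank hfin).mpr hsurj
  refine ⟨LinearEquiv.ofBijective e₀ ⟨hinj, hsurj⟩, fun x v => hb x v, q 1, ?_, fun x => ?_⟩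
  · have hq1 : (fun x : Π i, K i => c.act x (q 1)) = q := by
      funext x
      rw [← hq, mul_one]
    rw [hq1]
    exact q.bijective
  · rw [LinearEquiv.ofBijective_apply, ← hq, mul_one, he₀, q.symm_apply_apply, hΨ]

/-! ### §5. HEAD: the period isomorphism of a special pair -/

/-- **THE PERIOD ISOMORPHISM OF A CM SPECIAL PAIR** ([Deligne1971TravauxShimura] 4.18; [Milne2005ShimuraVarieties] Ex. 12.4 (b)
«`h_Φ(z)` acts on `V_φ` as multiplication by `φ(z)`»): for a special pair `(c, J, Φ)` on the Siegel datum (★ `IsSpecial`)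
there is an `ℝ`-linear isomorphism `e : ℝ^{2g} ≃ ∏ᵢ ℂ^{Φᵢ}` such that
(a) `e ∘ J = √−1 · e` — the complex structure `J` IS multiplication by `√−1`;
(b) `e ∘ act(x) = Ψ(x) · e` — the CM algebra `F = ∏ Kᵢ` acts through the diagonal embeddings `Ψ(x) = (φ(xᵢ))_{i,φ∈Φᵢ}`
    (★ `CMTypeLattice.cmEmbedding`);
(c) `e(act(x)·v₀) = Ψ(x)` for a cyclic vector `v₀` (`x ↦ act(x)·v₀` bijective `F → ℚ^{2g}`) — the rational structure
    `ℚ^{2g}` is carried onto `Ψ(F)`, so a lattice `L ⊂ ℚ^{2g}` becomes the lattice `Ψ(q⁻¹L) ⊂ ∏ᵢ ℂ^{Φᵢ}` of the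
    CM-torus currency (★ `CMTypeLattice.idealLattice`, ★ `CMTypeUniformization`'s `periodIso Φ 𝔞`).
I.e. `(ℝ^{2g}, J, act ⊃ ℚ^{2g}) ≅ ((F ⊗ ℝ)_Φ = ∏ᵢ ℂ^{Φᵢ}, √−1, F)`: the complex torus `(ℝ^{2g}, J)/L` of the special point
`[J, a]` is a CM-algebra torus of type `Φ`.  From §4 (the chart) and §3 (the eigenvector clause pins `J`).
[cite: Milne2005ShimuraVarieties, Ex. 12.4 (b) p. 112] [cite: Deligne1971TravauxShimura, 4.18 p. 150]
[cite: Shimura1998, §6.2 Thm. 3–4, pp. 42–45] -/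
theorem IsSpecial.exists_periodIso {c : CMStructure g δ ι K} {J : C0pm δ} {Φ : ∀ i, CMType (K i)}
    (h : c.IsSpecial J Φ) :
    ∃ e : (Fin g ⊕ Fin g → ℝ) ≃ₗ[ℝ] (Π i, ((Φ i).1 → ℂ)),
      (∀ v, e ((J : Matrix (Fin g ⊕ Fin g) (Fin g ⊕ Fin g) ℝ) *ᵥ v) = Complex.I • e v) ∧
      (∀ (x : Π i, K i) (v : Fin g ⊕ Fin g → ℝ),
        e ((c.actMatrix x).map (algebraMap ℚ ℝ) *ᵥ v) = (fun i => CMTypeLattice.cmEmbedding (Φ i) (x i)) * e v) ∧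
      ∃ v₀ : Fin g ⊕ Fin g → ℚ, Function.Bijective (fun x : Π i, K i => c.act x v₀) ∧
        ∀ x : Π i, K i, e ((algebraMap ℚ ℝ) ∘ (c.act x v₀)) = fun i => CMTypeLattice.cmEmbedding (Φ i) (x i) := by
  obtain ⟨e, hb, v₀, hv₀, hc⟩ := c.exists_linearEquiv_cmEmbedding Φ
  exact ⟨e, fun v => h.map_mulVec_eq_I_smul_of_equivariant e hb v, hb, v₀, hv₀, hc⟩

end CMStructure

end Literature.AlgebraicGeometry.ModuliOfAbelianVarieties

end
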